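import Literature.MathematicalPhysics.QuantumLattice.HubbardGrandCanonicalDensity
import Literature.MathematicalPhysics.QuantumLattice.XYZGroundStateOrderCorrIneq
import HarnessLib

/-!
# Particle–hole symmetry of the grand-canonical ground state of the Hubbard model:
# the density mirror `n(μ) + n(U - μ) = 2` and the exact half-filling anchor `n(U/2) = 1`

Topic `Literature/MathematicalPhysics/QuantumLattice`; a companion of `HubbardModelParticleHoleProofs.lean`
(the particle–hole unitary `P = particleHole ε` and `P H(t,U) Pᴴ = H(t,U) - U N + U|Λ|` on a bipartite graph,
Lieb 1989) and of `HubbardGrandCanonicalDensity.lean` (the grand-canonical tracial ground-state density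
`Re ω_μ(N)`, `ω_μ = Matrix.groundStateFunctional (hamiltonianWith G t U μ)`, its monotonicity in `μ` and
Griffiths' lemma).  Those files relate the CANONICAL sector energies `E(N) ↔ E(2|Λ| - N)`; the present file
proves the GRAND-CANONICAL consequence that every density clause of the Hubbard summit uses
(`… (hubbardTorusWith 2 (L+1) 1 U μ).groundStateFunctional totalNumber …`):

* `Matrix.groundEnergy_add_smul_one`, `Matrix.groundSpace_add_smul_one`, `Matrix.groundProj_add_smul_one`,
  `Matrix.groundStateFunctional_add_smul_one` — adding a real constant `c · 1` to a Hermitian matrix shifts the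
  ground energy by `c` and leaves ground space, ground projection and tracial ground state unchanged;
* `particleHole_mul_totalNumber_mul_conjTranspose` — `P N Pᴴ = 2|Λ| - N`;
* `particleHole_mul_hamiltonianWith_mul_conjTranspose` — on a bipartite graph,
  `P (H(t,U) - μN) Pᴴ = (H(t,U) - (U - μ)N) + (U - 2μ)|Λ|`: the grand-canonical Hamiltonian at `μ` is
  unitarily conjugate to the one at `U - μ` up to a constant (the mirror point is `μ = U/2`, half filling);
* `gcNumber_add_gcNumber_particleHole` — **`Re ω_μ(N) + Re ω_{U-μ}(N) = 2|Λ|`** for every `t, U, μ` on a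
  graph with a bipartite sign; `gcNumber_half_coupling` — **`Re ω_{U/2}(N) = |Λ|`** (density exactly one at
  `μ = U/2`, every coupling, every bipartite finite graph);
* torus forms (`(ℤ/Lℤ)^d` is bipartite iff `L` is even): `gcNumber_torus_add_gcNumber_particleHole`,
  `gcDensity_torus_half_coupling` (`n_L(t, U, U/2) = 1` for even `L ≠ 0`, `d = 2`), and in the `L + 1`
  indexing of the summit's density clauses `frequently_gcDensity_half_coupling_eq_one`
  (`∃ᶠ L, n_{L+1}(t,U,U/2) = 1`), the one-sided anchors `frequently_gcDensity_le_one` (`μ ≤ U/2`) and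
  `frequently_one_le_gcDensity` (`U/2 ≤ μ`), and the limit forms `le_one_of_tendsto_gcDensity`,
  `one_le_of_tendsto_gcDensity`, `eq_one_of_tendsto_gcDensity_half_coupling` (a limiting density at
  `μ = U/2`, if it exists along all sides, equals `1`) and `add_eq_two_of_tendsto_gcDensity` (limits at `μ`
  and `U - μ`, if both exist, add up to `2`).

The one-sided "frequently" anchors are exactly the hypotheses consumed by the density-bracket transport
(`exists_tendsto_gcDensity_of_bracket`, `HubbardGrandCanonicalDensityBracket.lean`; Theorems
`stub_densityOfBracket` of crux `CapRgSymmetricCertificatePinned`): at `μ₂ = U/2` the upper anchor `≤ 1`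
holds for free at EVERY coupling, so localising a limiting density in `[lo, 1]` needs only ONE lower bound
`lo ≤ n_{L+1}(U, μ₁)` frequently, at some `μ₁ < U/2`.

## Proof sketch

`P` is unitary (`particleHole_mul_conjTranspose`, `particleHole_conjTranspose_mul`), `P n_{xσ} Pᴴ = 1 - n_{xσ}`
(`particleHole_mul_numberAt_mul_conjTranspose_holds`), so `P N Pᴴ = 2|Λ| - N`; with Lieb's
`P H Pᴴ = H - UN + U|Λ|` (`hamiltonian_particleHole_bipartite_holds`) this gives the displayed conjugation of
`H - μN`.  The tracial ground state is covariant under unitary conjugation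
(`Matrix.groundStateFunctional_unitary_conj`) and invariant under constant shifts (this file), and
`ω(1) = 1` (`Matrix.groundStateFunctional_one`); hence `ω_μ(N) = ω_{U-μ}(2|Λ| - N) = 2|Λ| - ω_{U-μ}(N)`.
On the torus the bipartite sign is the stagger `(-1)^{Σxᵢ}` (`torusStagger_eq_neg_of_adj_holds`, even `L`).

## Sources

E. H. Lieb, *Two theorems on the Hubbard model*, PRL 62 (1989) 1201 (particle–hole transformation on
bipartite lattices, half filling at `μ = U/2`) [`LiebPRL1989`]; H. Tasaki, *Physics and Mathematics of
Quantum Many-Body Systems* (2020) §9.3.3, §10.1 [`Tasaki2020`]; E. H. Lieb, F. Y. Wu, Physica A 321 (2003) 1,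
§1 eq. (3).  Everything here is elementary finite-dimensional algebra ([folklore] tags); no definition and no
named fact is introduced.  NOT here: anything about odd tori (not bipartite), about the thermodynamic limit
itself, or about densities away from the mirror point.
-/

noncomputable section

open Filter Topology Finset

/-! ### Constant shifts of a Hermitian matrix do not change the ground state -/

namespace Matrix

variable {m : Type*} [Fintype m] [DecidableEq m]

omit [Fintype m] in
/-- A real multiple of the identity is Hermitian. [folklore] -/
theorem isHermitian_real_smul_one (c : ℝ) : ((c : ℂ) • (1 : Matrix m m ℂ)).IsHermitian := by
  rw [IsHermitian, conjTranspose_smul, conjTranspose_one, Complex.star_def, Complex.conj_ofReal]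

/-- The Rayleigh quotient of `A + c · 1` at a unit vector is that of `A` plus `c`. [folklore] -/
theorem re_rayleigh_add_smul_one (A : Matrix m m ℂ) (c : ℝ) {ψ : m → ℂ} (hψ : star ψ ⬝ᵥ ψ = 1) :
    (star ψ ⬝ᵥ (A + (c : ℂ) • (1 : Matrix m m ℂ)) *ᵥ ψ).re = (star ψ ⬝ᵥ A *ᵥ ψ).re + c := by
  rw [add_mulVec, smul_mulVec, one_mulVec, dotProduct_add, dotProduct_smul, hψ, smul_eq_mul, mul_one,
    Complex.add_re, Complex.ofReal_re]

/-- **`E₀(A + c·1) = E₀(A) + c`** for Hermitian `A` and real `c` (variational characterisation of the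
ground energy in both directions). Tasaki (2020) §2.1. [folklore] -/
theorem groundEnergy_add_smul_one [Nonempty m] {A : Matrix m m ℂ} (hA : A.IsHermitian) (c : ℝ) :
    (A + (c : ℂ) • (1 : Matrix m m ℂ)).groundEnergy = A.groundEnergy + c := by
  have hcA : (A + (c : ℂ) • (1 : Matrix m m ℂ)).IsHermitian := hA.add (isHermitian_real_smul_one c)
  refine le_antisymm ?_ ?_
  · obtain ⟨ψ, hψ1, hψE⟩ := exists_groundState_unit hA
    have h := groundEnergy_le_rayleigh_holds hcA ψ hψ1
    rw [re_rayleigh_add_smul_one A c hψ1, hψE] at h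
    exact h
  · obtain ⟨ψ, hψ1, hψE⟩ := exists_groundState_unit hcA
    have h := groundEnergy_le_rayleigh_holds hA ψ hψ1
    rw [re_rayleigh_add_smul_one A c hψ1] at hψE
    linarith

/-- The ground space is unchanged under `A ↦ A + c·1` (`c` real, `A` Hermitian). [folklore] -/
theorem groundSpace_add_smul_one [Nonempty m] {A : Matrix m m ℂ} (hA : A.IsHermitian) (c : ℝ) :
    (A + (c : ℂ) • (1 : Matrix m m ℂ)).groundSpace = A.groundSpace := by
  ext v
  rw [mem_groundSpace_iff, mem_groundSpace_iff, groundEnergy_add_smul_one hA c, add_mulVec, smul_mulVec,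
    one_mulVec, Complex.ofReal_add, add_smul]
  exact add_left_inj _

/-- The ground-state projection is unchanged under `A ↦ A + c·1` (`c` real, `A` Hermitian). [folklore] -/
theorem groundProj_add_smul_one [Nonempty m] {A : Matrix m m ℂ} (hA : A.IsHermitian) (c : ℝ) :
    (A + (c : ℂ) • (1 : Matrix m m ℂ)).groundProj = A.groundProj := by
  rw [groundProj_eq, groundProj_eq, groundSpace_add_smul_one hA c]

/-- **The tracial ground state is unchanged under `A ↦ A + c·1`** (`c` real, `A` Hermitian): an additive
constant in the Hamiltonian drops out of every ground-state expectation. Tasaki (2020) §2.1. [folklore] -/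
theorem groundStateFunctional_add_smul_one [Nonempty m] {A : Matrix m m ℂ} (hA : A.IsHermitian) (c : ℝ) :
    (A + (c : ℂ) • (1 : Matrix m m ℂ)).groundStateFunctional = A.groundStateFunctional := by
  ext O
  rw [groundStateFunctional_apply, groundStateFunctional_apply, groundProj_add_smul_one hA c]

end Matrix

namespace Literature.MathematicalPhysics.QuantumLattice

open Matrix Literature.Probability.LatticeModels

/-! ### The particle–hole conjugates of `N` and of `H(t,U) - μN` -/

section General

variable {Λ : Type*} [LinearOrder Λ] [Fintype Λ] (G : SimpleGraph Λ) [DecidableRel G.Adj]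

omit [Fintype Λ] in
/-- **`P N Pᴴ = 2|Λ| - N`**: the particle–hole transformation (unimodular phases) sends the total particle
number to the total hole number. Lieb, PRL 62 (1989) 1201; Tasaki (2020) §9.3.3. [folklore] -/
theorem particleHole_mul_totalNumber_mul_conjTranspose [Fintype Λ] (ε : Orb Λ → ℂ) (hε : ∀ i, ‖ε i‖ = 1) :
    particleHole ε * totalNumber * (particleHole ε)ᴴ =
      ((2 * Fintype.card Λ : ℕ) : ℂ) • (1 : Matrix (Finset (Orb Λ)) (Finset (Orb Λ)) ℂ) - totalNumber := by
  have hnum : ∀ (x : Λ) (σ : Fin 2),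
      particleHole ε * numberOp x σ * (particleHole ε)ᴴ = 1 - numberOp x σ := by
    intro x σ
    have h := particleHole_mul_numberAt_mul_conjTranspose_holds ε hε (orb x σ)
    simpa using h
  have h2 : (totalNumber : Matrix (Finset (Orb Λ)) (Finset (Orb Λ)) ℂ) =
      ∑ x : Λ, (numberOp x 0 + numberOp x 1) := by
    unfold totalNumber
    simp [Fin.sum_univ_two]
  have h1 : ∀ x : Λ, particleHole ε * (numberOp x 0 + numberOp x 1) * (particleHole ε)ᴴ =
      (2 : ℂ) • (1 : Matrix (Finset (Orb Λ)) (Finset (Orb Λ)) ℂ) - (numberOp x 0 + numberOp x 1) := by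
    intro x
    rw [Matrix.mul_add, Matrix.add_mul, hnum, hnum, two_smul]
    abel
  rw [h2, Finset.mul_sum, Finset.sum_mul]
  simp only [h1, Finset.sum_sub_distrib, Finset.sum_const, Finset.card_univ]
  congr 1
  rw [← Nat.cast_smul_eq_nsmul ℂ, smul_smul]
  push_cast
  ring_nf

/-- **Particle–hole conjugation of the grand-canonical Hamiltonian on a bipartite graph**:
`P (H(t,U) - μN) Pᴴ = (H(t,U) - (U - μ)N) + (U - 2μ)|Λ| · 1`, i.e. `hamiltonianWith G t U μ` is unitarily
conjugate to `hamiltonianWith G t U (U - μ)` up to an additive constant; the fixed point is `μ = U/2`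
(half filling).  From Lieb's `P H Pᴴ = H - UN + U|Λ|` and `P N Pᴴ = 2|Λ| - N`.
Lieb, PRL 62 (1989) 1201; Tasaki (2020) §9.3.3, §10.1. [folklore] -/
theorem particleHole_mul_hamiltonianWith_mul_conjTranspose (ε : Λ → ℤˣ)
    (hε : ∀ x y, G.Adj x y → ε x = -ε y) (t U μ : ℝ) :
    particleHole (fun i : Orb Λ => ((ε (ofLex i).1 : ℤ) : ℂ)) * hamiltonianWith G t U μ *
        (particleHole (fun i : Orb Λ => ((ε (ofLex i).1 : ℤ) : ℂ)))ᴴ =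
      hamiltonianWith G t U (U - μ) +
        (((U - 2 * μ) * Fintype.card Λ : ℝ) : ℂ) • (1 : Matrix (Finset (Orb Λ)) (Finset (Orb Λ)) ℂ) := by
  set ε' : Orb Λ → ℂ := fun i => ((ε (ofLex i).1 : ℤ) : ℂ) with hε'
  have hn : ∀ i, ‖ε' i‖ = 1 := fun i => norm_intCast_units _
  have hH := hamiltonian_particleHole_bipartite_holds G t U ε hε
  have hN := particleHole_mul_totalNumber_mul_conjTranspose ε' hn
  rw [hamiltonianWith, hamiltonianWith, Matrix.mul_sub, Matrix.sub_mul, Matrix.mul_smul, Matrix.smul_mul,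
    hH, hN]
  push_cast
  module

/-! ### The grand-canonical density mirror -/

/-- **Particle–hole mirror of the grand-canonical ground-state density** (bipartite graph, any `t, U, μ`):
`Re ω_μ(N) + Re ω_{U-μ}(N) = 2|Λ|`, `ω_μ` the tracial ground state of `H(t,U) - μN`.  (Unitary covariance
of the tracial ground state under `P`, invariance under the constant, `ω(1) = 1`.)
Lieb, PRL 62 (1989) 1201. [folklore] -/
theorem gcNumber_add_gcNumber_particleHole (ε : Λ → ℤˣ) (hε : ∀ x y, G.Adj x y → ε x = -ε y)
    (t U μ : ℝ) :
    ((hamiltonianWith G t U μ).groundStateFunctional totalNumber).re +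
        ((hamiltonianWith G t U (U - μ)).groundStateFunctional totalNumber).re =
      2 * Fintype.card Λ := by
  set ε' : Orb Λ → ℂ := fun i => ((ε (ofLex i).1 : ℤ) : ℂ) with hε'
  have hn : ∀ i, ‖ε' i‖ = 1 := fun i => norm_intCast_units _
  have hPP' : particleHole ε' * (particleHole ε')ᴴ = 1 := particleHole_mul_conjTranspose ε' hn
  have hP'P : (particleHole ε')ᴴ * particleHole ε' = 1 := particleHole_conjTranspose_mul ε' hn
  have hherm := isHermitian_hamiltonianWith G t U (U - μ)
  have key : (hamiltonianWith G t U μ).groundStateFunctional totalNumber =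
      ((2 * Fintype.card Λ : ℕ) : ℂ) -
        (hamiltonianWith G t U (U - μ)).groundStateFunctional totalNumber := by
    rw [← Matrix.groundStateFunctional_unitary_conj hPP' hP'P (A := hamiltonianWith G t U μ) totalNumber,
      particleHole_mul_hamiltonianWith_mul_conjTranspose G ε hε t U μ,
      particleHole_mul_totalNumber_mul_conjTranspose ε' hn,
      Matrix.groundStateFunctional_add_smul_one hherm, map_sub, map_smul,
      Matrix.groundStateFunctional_one hherm, smul_eq_mul, mul_one]
  rw [key, Complex.sub_re, Complex.natCast_re]
  push_cast
  ring

/-- **Exact half filling at `μ = U/2`**: `Re ω_{U/2}(N) = |Λ|` on every finite graph with a bipartite sign,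
for every hopping `t` and coupling `U` (the mirror identity at its fixed point).
Lieb, PRL 62 (1989) 1201. [folklore] -/
theorem gcNumber_half_coupling (ε : Λ → ℤˣ) (hε : ∀ x y, G.Adj x y → ε x = -ε y) (t U : ℝ) :
    ((hamiltonianWith G t U (U / 2)).groundStateFunctional totalNumber).re = Fintype.card Λ := by
  have h := gcNumber_add_gcNumber_particleHole G ε hε t U (U / 2)
  rw [show U - U / 2 = U / 2 by ring] at h
  linarith

end General

/-! ### Torus forms (even side: the torus is bipartite), in the normalisation of the density clauses -/

section Torus

/-- **Density mirror on the even torus** `(ℤ/Lℤ)^d`, `L` even: for `hubbardTorusWith d L t U ·`,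
`Re ω_μ(N) + Re ω_{U-μ}(N) = 2 L^d`. Lieb, PRL 62 (1989) 1201. [folklore] -/
theorem gcNumber_torus_add_gcNumber_particleHole {d L : ℕ} (hL : Even L) (t U μ : ℝ) :
    ((hubbardTorusWith d L t U μ).groundStateFunctional totalNumber).re +
        ((hubbardTorusWith d L t U (U - μ)).groundStateFunctional totalNumber).re =
      2 * (L : ℝ) ^ d := by
  have h := gcNumber_add_gcNumber_particleHole (fermionTorusGraph d L) torusStagger
    (fun _ _ hxy => torusStagger_eq_neg_of_adj_holds hL hxy) t U μ
  rw [card_fermionTorus d] at h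
  push_cast at h
  unfold hubbardTorusWith
  convert h

/-- **Exact half filling on the even torus**: `Re ω[hubbardTorusWith d L t U (U/2)](N) = L^d` for even `L`.
Lieb, PRL 62 (1989) 1201. [folklore] -/
theorem gcNumber_torus_half_coupling {d L : ℕ} (hL : Even L) (t U : ℝ) :
    ((hubbardTorusWith d L t U (U / 2)).groundStateFunctional totalNumber).re = (L : ℝ) ^ d := by
  have h := gcNumber_torus_add_gcNumber_particleHole (d := d) hL t U (U / 2)
  rw [show U - U / 2 = U / 2 by ring] at h
  linarith

/-- **The half-filling anchor, density form** (`d = 2`, even `L ≠ 0`): the grand-canonical tracial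
ground-state density per site of `hubbardTorusWith 2 L t U (U/2)` is exactly `1`. Lieb, PRL 62 (1989) 1201.
[folklore] -/
theorem gcDensity_torus_half_coupling {L : ℕ} (hL : Even L) (hL0 : L ≠ 0) (t U : ℝ) :
    ((hubbardTorusWith 2 L t U (U / 2)).groundStateFunctional totalNumber).re / (L : ℝ) ^ 2 = 1 := by
  rw [gcNumber_torus_half_coupling hL t U]
  have hL' : (L : ℝ) ^ 2 ≠ 0 := by positivity
  exact div_self hL'

/-- **The anchor in the `L + 1` indexing of the summit's density clauses**: frequently in `L` (namely at
every odd `L`, even side `L + 1`), `n_{L+1}(t, U, U/2) = 1`. Lieb, PRL 62 (1989) 1201. [folklore] -/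
theorem frequently_gcDensity_half_coupling_eq_one (t U : ℝ) :
    ∃ᶠ L : ℕ in atTop, ((hubbardTorusWith 2 (L + 1) t U (U / 2)).groundStateFunctional totalNumber).re /
      ((L + 1 : ℕ) : ℝ) ^ 2 = 1 := by
  refine frequently_atTop.2 fun N => ⟨2 * N + 1, by omega, ?_⟩
  exact gcDensity_torus_half_coupling ⟨N + 1, by ring⟩ (by omega) t U

/-- **Upper anchor below half filling**: for `μ ≤ U/2`, frequently in `L` (even sides),
`n_{L+1}(t, U, μ) ≤ 1` (anchor `= 1` at `U/2` and monotonicity of the density in `μ`). This is the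
`(μ₂, hi) = (U/2, 1)` instance of the upper hypothesis of `exists_tendsto_gcDensity_of_bracket`.
Lieb, PRL 62 (1989) 1201; Koma–Tasaki, J. Stat. Phys. 76 (1994) 745, §1. [folklore] -/
theorem frequently_gcDensity_le_one (t U : ℝ) {μ : ℝ} (hμ : μ ≤ U / 2) :
    ∃ᶠ L : ℕ in atTop, ((hubbardTorusWith 2 (L + 1) t U μ).groundStateFunctional totalNumber).re /
      ((L + 1 : ℕ) : ℝ) ^ 2 ≤ 1 := by
  refine (frequently_gcDensity_half_coupling_eq_one t U).mono fun L hL => ?_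
  rw [← hL]
  exact div_le_div_of_nonneg_right (gcNumber_torus_mono (L + 1) t U hμ) (by positivity)

/-- **Lower anchor above half filling**: for `U/2 ≤ μ`, frequently in `L` (even sides),
`1 ≤ n_{L+1}(t, U, μ)`. Lieb, PRL 62 (1989) 1201; Koma–Tasaki, J. Stat. Phys. 76 (1994) 745, §1. [folklore] -/
theorem frequently_one_le_gcDensity (t U : ℝ) {μ : ℝ} (hμ : U / 2 ≤ μ) :
    ∃ᶠ L : ℕ in atTop, 1 ≤ ((hubbardTorusWith 2 (L + 1) t U μ).groundStateFunctional totalNumber).re /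
      ((L + 1 : ℕ) : ℝ) ^ 2 := by
  refine (frequently_gcDensity_half_coupling_eq_one t U).mono fun L hL => ?_
  rw [← hL]
  exact div_le_div_of_nonneg_right (gcNumber_torus_mono (L + 1) t U hμ) (by positivity)

/-- **Limit form, below half filling**: if the density `n_{L+1}(t, U, μ)` converges along all sides and
`μ ≤ U/2`, its limit is `≤ 1`. [folklore] -/
theorem le_one_of_tendsto_gcDensity (t U : ℝ) {μ ρ : ℝ} (hμ : μ ≤ U / 2)
    (h : Tendsto (fun L : ℕ => ((hubbardTorusWith 2 (L + 1) t U μ).groundStateFunctional totalNumber).re /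
      ((L + 1 : ℕ) : ℝ) ^ 2) atTop (𝓝 ρ)) : ρ ≤ 1 :=
  isClosed_Iic.mem_of_frequently_of_tendsto (frequently_gcDensity_le_one t U hμ) h

/-- **Limit form, above half filling**: if the density `n_{L+1}(t, U, μ)` converges along all sides and
`U/2 ≤ μ`, its limit is `≥ 1`. [folklore] -/
theorem one_le_of_tendsto_gcDensity (t U : ℝ) {μ ρ : ℝ} (hμ : U / 2 ≤ μ)
    (h : Tendsto (fun L : ℕ => ((hubbardTorusWith 2 (L + 1) t U μ).groundStateFunctional totalNumber).re /
      ((L + 1 : ℕ) : ℝ) ^ 2) atTop (𝓝 ρ)) : 1 ≤ ρ :=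
  isClosed_Ici.mem_of_frequently_of_tendsto (frequently_one_le_gcDensity t U hμ) h

/-- **Limit form at the mirror point**: a limiting density at `μ = U/2` along all sides, if it exists, is
`1`; in particular a density clause `n_{L+1}(t, U, U/2) → 1 - δ` forces `δ = 0`. [folklore] -/
theorem eq_one_of_tendsto_gcDensity_half_coupling (t U : ℝ) {ρ : ℝ}
    (h : Tendsto (fun L : ℕ => ((hubbardTorusWith 2 (L + 1) t U (U / 2)).groundStateFunctional
      totalNumber).re / ((L + 1 : ℕ) : ℝ) ^ 2) atTop (𝓝 ρ)) : ρ = 1 :=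
  le_antisymm (le_one_of_tendsto_gcDensity t U le_rfl h) (one_le_of_tendsto_gcDensity t U le_rfl h)

/-- **Limit form of the mirror**: if the densities at `μ` and at `U - μ` both converge along all sides, the
limits add up to `2` (the even sides carry the identity to the limit). Lieb, PRL 62 (1989) 1201. [folklore] -/
theorem add_eq_two_of_tendsto_gcDensity (t U μ : ℝ) {ρ ρ' : ℝ}
    (h : Tendsto (fun L : ℕ => ((hubbardTorusWith 2 (L + 1) t U μ).groundStateFunctional totalNumber).re /
      ((L + 1 : ℕ) : ℝ) ^ 2) atTop (𝓝 ρ))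
    (h' : Tendsto (fun L : ℕ => ((hubbardTorusWith 2 (L + 1) t U (U - μ)).groundStateFunctional
      totalNumber).re / ((L + 1 : ℕ) : ℝ) ^ 2) atTop (𝓝 ρ')) : ρ + ρ' = 2 := by
  have hsum := h.add h'
  have hfreq : ∃ᶠ L : ℕ in atTop,
      ((hubbardTorusWith 2 (L + 1) t U μ).groundStateFunctional totalNumber).re / ((L + 1 : ℕ) : ℝ) ^ 2 +
        ((hubbardTorusWith 2 (L + 1) t U (U - μ)).groundStateFunctional totalNumber).re /
          ((L + 1 : ℕ) : ℝ) ^ 2 = 2 := by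
    refine frequently_atTop.2 fun N => ⟨2 * N + 1, by omega, ?_⟩
    have hE : Even (2 * N + 1 + 1) := ⟨N + 1, by ring⟩
    have hne : (((2 * N + 1 + 1 : ℕ) : ℝ)) ^ 2 ≠ 0 := by positivity
    rw [← add_div, gcNumber_torus_add_gcNumber_particleHole (d := 2) hE t U μ, mul_div_assoc, div_self hne,
      mul_one]
  exact (isClosed_singleton (x := (2 : ℝ))).mem_of_frequently_of_tendsto hfreq hsum

end Torus

end Literature.MathematicalPhysics.QuantumLattice

end
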